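import Summits.MatrixMultiplication.OmegaCensus.STPPSmallPatternT1K8OrderLaw45
import Summits.MatrixMultiplication.OmegaCensus.STPPSmallPatternEvenOrderLift
import Summits.MatrixMultiplication.OmegaCensus.STPPSmallPatternCyclicFatLifts

/-!
# ω-census, small pattern `(1,2,2)⁸`: hosts from order `90` (even orders) — the fat lifts of the `(2,1,1)⁸` onset-45 law (kernel)

Cell `pub-omega`, ω construction census, seat pub-omega ENG2 (gen 35). HONEST FRAMING (verbatim): lottery ticket; floor =
certified bounds/negative ranges.  Census STRUCTURE bookkeeping (row B5, column `T2` at `k = 8`; conjecture C10 (a) LIFT-TIGHT predicts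
`onset_T2(8) = 2 · onset_T1(8)`, i.e. `90` now that `onset_T1(8) = 45` at mirror level / `≤ 45` in the kernel); nothing here bears on `ω`.

The `T2` column of record at `k = 8` read «every finite abelian group of order `≥ 96` other than `97, 99` hosts `(1,2,2)⁸`»
(`exists_isSTPP_122pow8_of_card_ge_96_of_ne`).  The new `T1` law `exists_isSTPP_211pow8_of_card_ge_45` and the tree's lifts give at once:

* `exists_isSTPP_122pow8_zmod_two_mul` — **`(1,2,2)⁸ ⊆ ℤ/2n` for every `n ≥ 45`** (so `ℤ/90, ℤ/92, ℤ/94` are new cyclic hosts);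
* `exists_isSTPP_122pow8_of_even_card_ge_90` — **every finite abelian group of EVEN order `≥ 90` hosts `(1,2,2)⁸`** (`onset_T2(8) ≤ 90`);
* `exists_isSTPP_222pow8_of_four_dvd_card_ge_180` — every finite abelian group of order `≥ 180` divisible by `4` hosts `(2,2,2)⁸`
  (no news for `n₈ ≤ 144`; recorded for the lift chain).

Open at `k = 8` after this file: odd orders `91, 93, 95, 97, 99` (and whether any group of order `< 90` hosts `(1,2,2)⁸`).
References: H. Cohn, R. Kleinberg, B. Szegedy, C. Umans, *Group-theoretic algorithms for matrix multiplication*, FOCS 2005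
(arXiv:math/0511460), Def. 5.1.  Seat pub-omega ENG2 (gen 35), 2026-08-29.
-/

open Literature.Computability.AlgebraicComplexity Finset

universe u

namespace Summit.MatrixMultiplication.OmegaCensus

/-- **`(1,2,2)⁸ ⊆ ℤ/2n` for every `n ≥ 45`** (fat lift of the cyclic `(2,1,1)⁸` ray from `45`). [cite: CohnKleinbergSzegedyUmans2005, Def. 5.1] -/
theorem exists_isSTPP_122pow8_zmod_two_mul (n : ℕ) (hn : 45 ≤ n) :
    ∃ A B C : Fin 8 → Finset (ZMod (2 * n)), IsSTPP A B C ∧ ∀ i, (A i).card = 1 ∧ (B i).card = 2 ∧ (C i).card = 2 :=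
  haveI : NeZero n := ⟨by omega⟩
  exists_isSTPP_122pow_zmod_two_mul_of_211pow (exists_isSTPP_211pow8_zmod_of_le45 n hn)

/-- **Every finite abelian group of even order `≥ 90` hosts `(1,2,2)⁸`** (even-order lift of the `(2,1,1)⁸` law at `45`).
[cite: CohnKleinbergSzegedyUmans2005, Def. 5.1] -/
theorem exists_isSTPP_122pow8_of_even_card_ge_90 {G : Type u} [AddCommGroup G] [Finite G] (heven : Even (Nat.card G))
    (hG : 90 ≤ Nat.card G) :
    ∃ A B C : Fin 8 → Finset G, IsSTPP A B C ∧ ∀ i, (A i).card = 1 ∧ (B i).card = 2 ∧ (C i).card = 2 :=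
  exists_isSTPP_122_of_even_card_of_law (N := 45) (fun Q _ _ hQ => exists_isSTPP_211pow8_of_card_ge_45 hQ) heven (by omega)

/-- Every finite abelian group of order `≥ 180` divisible by `4` hosts `(2,2,2)⁸` (double lift of the `(2,1,1)⁸` law at `45`; no news for
`n₈ ≤ 144`). [cite: CohnKleinbergSzegedyUmans2005, Def. 5.1] -/
theorem exists_isSTPP_222pow8_of_four_dvd_card_ge_180 {G : Type u} [AddCommGroup G] [Finite G] (h4 : 4 ∣ Nat.card G)
    (hG : 180 ≤ Nat.card G) :
    ∃ A B C : Fin 8 → Finset G, IsSTPP A B C ∧ ∀ i, (A i).card = 2 ∧ (B i).card = 2 ∧ (C i).card = 2 :=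
  exists_isSTPP_222_of_four_dvd_card_of_law (N := 45) (fun Q _ _ hQ => exists_isSTPP_211pow8_of_card_ge_45 hQ) h4 (by omega)

end Summit.MatrixMultiplication.OmegaCensus
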